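import Literature.Geometry.Symplectic.JHolomorphicMap
import Mathlib.Geometry.Manifold.VectorBundle.Hom
import Mathlib.Geometry.Manifold.VectorBundle.Tangent
import Mathlib.Geometry.Manifold.MFDeriv.Tangent
import Mathlib.Geometry.Manifold.MFDeriv.Atlas
import Mathlib.Geometry.Manifold.ContMDiff.Atlas
import Mathlib.Geometry.Manifold.ContMDiff.NormedSpace
import Mathlib.Geometry.Manifold.ContMDiffMFDeriv
import Mathlib.Geometry.Manifold.Instances.Real
import Mathlib.Analysis.InnerProductSpace.PiL2
import Mathlib.Analysis.Calculus.BumpFunction.FiniteDimension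
import HarnessLib

/-!
# Chart localisation of almost complex structures and `J`-holomorphic curves (dimension four)

Folklore calculus used to reduce local statements about `J`-holomorphic curves `G : ℂ → V` in a
smooth almost complex `4`-manifold `(V, J)` — stated, as in
`Literature/Geometry/Symplectic/JHolomorphicLocalIntersections.lean`, with `J` a raw family of
tangent-space endomorphisms, `J² = -1`, smooth "in tangent coordinates"
(`inTangentCoordinates (𝓡 4) (𝓡 4) id id J x₀` is `C^∞` at `x₀` for every `x₀`) and
`IsJHolomorphic (𝓡 4) J G` — to FLAT statements in `ℝ⁴ = EuclideanSpace ℝ (Fin 4)` about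
globally smooth maps `u : ℂ → ℝ⁴` which are `J'`-holomorphic (`du (iα) = J' (u z) (du α)`) on a
disc for a globally smooth operator field `J' : ℝ⁴ → (ℝ⁴ →L[ℝ] ℝ⁴)`; this is the form consumed by
the flat local theory of the tree (`Literature.Geometry.Symplectic.sheet_dichotomy`,
`JHolomorphicSheetDichotomy.lean`).

## Contents (namespace `Literature.Geometry.Symplectic`)

* `exists_smooth_ballRetraction` — a `C^∞` map `rt : E → E` with values in `ball c δ` and equal to
  the identity on `closedBall c (δ/2)` (a bump-function cut-off; used to globalise maps which are
  only defined / smooth on a chart);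
* `inTangentCoordinates_contMDiffOn_chartSource` — the frame expression of `J` at `x₀` is `C^∞`
  on the whole chart domain of `x₀` (vector-bundle section API: `contMDiffAt_hom_bundle`,
  `Trivialization.contMDiffOn_section_baseSet_iff`);
* `exists_coordinateACS` — the coordinate almost complex structure `Jc` on the chart target
  (`C^∞` there, `Jc² = -1`, equal to the frame expression along the chart) and
  `exists_coordinateACS_global` — a GLOBALLY `C^∞` field `J'` on `ℝ⁴` with the same two
  properties on a ball about the image of `x₀`;
* `jHolomorphic_fderiv_chart` — a `J`-holomorphic curve is flat-holomorphic in a chart for the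
  frame expression of `J` (chain rule, `inTangentCoordinates_eq_mfderiv_comp`, and the left
  inverse `mfderivWithin_extChartAt_symm_comp_mfderiv_extChartAt'`);
* `exists_chartCurve_global` — for a smooth `J`-holomorphic `G : ℂ → V` and a chart centred at
  `G z₀`, a globally `C^∞` map `u : ℂ → ℝ⁴` agreeing with the chart expression of `G` on a disc
  about `z₀`, `J'`-holomorphic there, with `du(z₀)` injective when `dG(z₀)` is.

The chart-calculus lemmas are the Literature-side versions of the helper stubs proved on the
summit side in `Summits/SmoothPoincare4/SmoothPoincare4/Theorems/SullivanDualWitnessChargeHelper*.lean`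
(Literature may not import `Summits`). Nothing here is specific to `J`-holomorphic curve theory
beyond the definition `IsJHolomorphic`; no named facts are introduced.
-/

noncomputable section

open scoped Manifold ContDiff Topology Bundle
open Set Function Metric Filter

namespace Literature.Geometry.Symplectic

/-! ### A smooth cut-off retraction onto a ball -/

/-- **Smooth retraction onto a ball.** In a real normed space with smooth bump functions, for
every centre `c` and radius `δ > 0` there is a `C^∞` map `rt` with `rt y ∈ ball c δ` for all `y`
and `rt y = y` on `closedBall c (δ / 2)`: `rt y = c + χ y • (y - c)` for a smooth bump `χ` equal to
`1` on `closedBall c (δ/2)` and supported in `ball c δ`. [folklore] -/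
theorem exists_smooth_ballRetraction {E' : Type*} [NormedAddCommGroup E'] [NormedSpace ℝ E']
    [HasContDiffBump E'] (c : E') {δ : ℝ} (hδ : 0 < δ) :
    ∃ rt : E' → E', ContDiff ℝ ∞ rt ∧ (∀ y, rt y ∈ ball c δ) ∧
      ∀ y ∈ closedBall c (δ / 2), rt y = y := by
  let χ : ContDiffBump c := ⟨δ / 2, δ, by positivity, by linarith⟩
  refine ⟨fun y => c + χ y • (y - c), ?_, ?_, ?_⟩
  · exact contDiff_const.add (χ.contDiff.smul (contDiff_id.sub contDiff_const))
  · intro y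
    rw [mem_ball, dist_eq_norm, add_sub_cancel_left, norm_smul, Real.norm_of_nonneg χ.nonneg]
    by_cases hy : dist y c < δ
    · rw [dist_eq_norm] at hy
      calc χ y * ‖y - c‖ ≤ 1 * ‖y - c‖ := by gcongr; exact χ.le_one
        _ < δ := by rwa [one_mul]
    · rw [χ.zero_of_le_dist (not_lt.1 hy), zero_mul]
      exact hδ
  · intro y hy
    show c + χ y • (y - c) = y
    rw [χ.one_of_mem_closedBall hy, one_smul, add_sub_cancel]

/-! ### The frame expression of `J` and the coordinate almost complex structure -/

section Chart

variable {M : Type*} [TopologicalSpace M] [ChartedSpace (EuclideanSpace ℝ (Fin 4)) M]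
  [IsManifold (𝓡 4) ∞ M]

/-- **The frame expression of a smooth endomorphism field is smooth on the whole chart.** If,
for every `x₀ : M`, the expression `x ↦ inTangentCoordinates (𝓡 4) (𝓡 4) id id J x₀ x` of a field
of endomorphisms `J x : T_x M →L[ℝ] T_x M` in the trivialization of the tangent bundle at `x₀` is
`C^∞` at `x₀`, then for every `x₀` it is `C^∞` on the whole chart domain `(chartAt _ x₀).source`:
`J` is then a `C^∞` section of the hom bundle `Hom(TM, TM)` (`contMDiffAt_hom_bundle`), and a
`C^∞` section read in the trivialization at `x₀` is `C^∞` on its base set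
(`Trivialization.contMDiffOn_section_baseSet_iff`), the chart domain of `x₀`. [folklore] -/
theorem inTangentCoordinates_contMDiffOn_chartSource
    (J : ∀ x : M, TangentSpace (𝓡 4) x →L[ℝ] TangentSpace (𝓡 4) x)
    (hJ : ∀ x₀ : M, ContMDiffAt (𝓡 4)
      𝓘(ℝ, EuclideanSpace ℝ (Fin 4) →L[ℝ] EuclideanSpace ℝ (Fin 4)) ∞
      (inTangentCoordinates (𝓡 4) (𝓡 4) (id : M → M) id (fun x => J x) x₀) x₀) (x₀ : M) :
    ContMDiffOn (𝓡 4) 𝓘(ℝ, EuclideanSpace ℝ (Fin 4) →L[ℝ] EuclideanSpace ℝ (Fin 4)) ∞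
      (inTangentCoordinates (𝓡 4) (𝓡 4) (id : M → M) id (fun x => J x) x₀)
      (chartAt (EuclideanSpace ℝ (Fin 4)) x₀).source := by
  -- `J` as a section of the hom bundle `Hom(TM, TM)` is `C^∞` everywhere
  have hsec : ContMDiff (𝓡 4)
      ((𝓡 4).prod 𝓘(ℝ, EuclideanSpace ℝ (Fin 4) →L[ℝ] EuclideanSpace ℝ (Fin 4))) ∞
      (fun x : M ↦ Bundle.TotalSpace.mk'
        (EuclideanSpace ℝ (Fin 4) →L[ℝ] EuclideanSpace ℝ (Fin 4))
        (E := fun x : M ↦ TangentSpace (𝓡 4) x →L[ℝ] TangentSpace (𝓡 4) x) x (J x)) := by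
    intro x
    rw [contMDiffAt_hom_bundle]
    exact ⟨contMDiffAt_id, hJ x⟩
  -- the trivialization of the hom bundle at `x₀`; its base set is the chart domain of `x₀`
  set e := trivializationAt (EuclideanSpace ℝ (Fin 4) →L[ℝ] EuclideanSpace ℝ (Fin 4))
    (fun x : M ↦ TangentSpace (𝓡 4) x →L[ℝ] TangentSpace (𝓡 4) x) x₀ with he
  have h1 : ContMDiffOn (𝓡 4) 𝓘(ℝ, EuclideanSpace ℝ (Fin 4) →L[ℝ] EuclideanSpace ℝ (Fin 4)) ∞
      (fun x ↦ (e ⟨x, J x⟩).2) e.baseSet :=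
    (e.contMDiffOn_section_baseSet_iff).1 hsec.contMDiffOn
  have hbase : e.baseSet = (chartAt (EuclideanSpace ℝ (Fin 4)) x₀).source := by
    rw [he, hom_trivializationAt_baseSet, TangentBundle.trivializationAt_baseSet, inter_self]
  rw [← hbase]
  refine h1.congr fun x _ ↦ ?_
  rw [he, hom_trivializationAt_apply]
  rfl

/-- **The coordinate almost complex structure on a chart target.** Let `J` be a field of
endomorphisms of the tangent spaces of `M` with `J x ∘ J x = -1`, smooth in tangent coordinates
at every point. Then for every `x₀` there is a field `Jc` of endomorphisms of `ℝ⁴`, `C^∞` on the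
target of the extended chart at `x₀`, with `Jc y (Jc y v) = -v` there, and agreeing with the frame
expression of `J` along the chart: `Jc (extChartAt (𝓡 4) x₀ x) = inTangentCoordinates … x₀ x` for
`x` in the chart domain. Take `Jc y := inTangentCoordinates … x₀ ((extChartAt (𝓡 4) x₀).symm y)`;
the square is computed through `inTangentCoordinates_eq` and the cocycle identities
`tangentCoordChange_comp` / `tangentCoordChange_self`. [folklore] -/
theorem exists_coordinateACS
    (J : ∀ x : M, TangentSpace (𝓡 4) x →L[ℝ] TangentSpace (𝓡 4) x)
    (hJ2 : ∀ (x : M) (v : TangentSpace (𝓡 4) x), J x (J x v) = -v)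
    (hsm : ∀ x₀ : M, ContMDiffAt (𝓡 4)
      𝓘(ℝ, EuclideanSpace ℝ (Fin 4) →L[ℝ] EuclideanSpace ℝ (Fin 4)) ∞
      (inTangentCoordinates (𝓡 4) (𝓡 4) (id : M → M) id (fun x => J x) x₀) x₀) (x₀ : M) :
    ∃ Jc : EuclideanSpace ℝ (Fin 4) → EuclideanSpace ℝ (Fin 4) →L[ℝ] EuclideanSpace ℝ (Fin 4),
      ContDiffOn ℝ ∞ Jc (extChartAt (𝓡 4) x₀).target ∧
      (∀ y ∈ (extChartAt (𝓡 4) x₀).target, ∀ v, Jc y (Jc y v) = -v) ∧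
      ∀ x ∈ (chartAt (EuclideanSpace ℝ (Fin 4)) x₀).source,
        Jc (extChartAt (𝓡 4) x₀ x) =
          inTangentCoordinates (𝓡 4) (𝓡 4) (id : M → M) id (fun x => J x) x₀ x := by
  -- points of the chart target are sent into the chart domain by the inverse extended chart
  have hsrc : ∀ y ∈ (extChartAt (𝓡 4) x₀).target,
      (extChartAt (𝓡 4) x₀).symm y ∈ (chartAt (EuclideanSpace ℝ (Fin 4)) x₀).source :=
    fun y hy => by
    rw [← extChartAt_source (𝓡 4)]
    exact (extChartAt (𝓡 4) x₀).map_target hy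
  -- the frame expression of `J` at `x₀`, as `A ∘ J x ∘ B` with `A`, `B` mutually inverse
  have hexpr : ∀ {x : M}, x ∈ (chartAt (EuclideanSpace ℝ (Fin 4)) x₀).source →
      ∀ w : EuclideanSpace ℝ (Fin 4),
        inTangentCoordinates (𝓡 4) (𝓡 4) (id : M → M) id (fun x => J x) x₀ x w =
          tangentCoordChange (𝓡 4) x x₀ x (J x (tangentCoordChange (𝓡 4) x₀ x x w)) :=
    fun {x} hx w => by
    rw [inTangentCoordinates_eq (I := 𝓡 4) (I' := 𝓡 4) (id : M → M) id (fun x => J x) hx hx]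
    rfl
  have hBA : ∀ {x : M}, x ∈ (chartAt (EuclideanSpace ℝ (Fin 4)) x₀).source →
      ∀ w : EuclideanSpace ℝ (Fin 4),
        tangentCoordChange (𝓡 4) x₀ x x (tangentCoordChange (𝓡 4) x x₀ x w) = w :=
    fun {x} hx w => by
    have hx' : x ∈ (extChartAt (𝓡 4) x₀).source := by rwa [extChartAt_source]
    rw [tangentCoordChange_comp ⟨⟨mem_extChartAt_source x, hx'⟩, mem_extChartAt_source x⟩]
    exact tangentCoordChange_self (mem_extChartAt_source x)
  have hAB : ∀ {x : M}, x ∈ (chartAt (EuclideanSpace ℝ (Fin 4)) x₀).source →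
      ∀ w : EuclideanSpace ℝ (Fin 4),
        tangentCoordChange (𝓡 4) x x₀ x (tangentCoordChange (𝓡 4) x₀ x x w) = w :=
    fun {x} hx w => by
    have hx' : x ∈ (extChartAt (𝓡 4) x₀).source := by rwa [extChartAt_source]
    rw [tangentCoordChange_comp ⟨⟨hx', mem_extChartAt_source x⟩, hx'⟩]
    exact tangentCoordChange_self hx'
  refine ⟨fun y => inTangentCoordinates (𝓡 4) (𝓡 4) (id : M → M) id (fun x => J x) x₀
      ((extChartAt (𝓡 4) x₀).symm y), ?_, ?_, ?_⟩
  · -- smoothness on the chart target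
    have hmaps : (extChartAt (𝓡 4) x₀).target ⊆
        (extChartAt (𝓡 4) x₀).symm ⁻¹' (chartAt (EuclideanSpace ℝ (Fin 4)) x₀).source :=
      fun y hy => hsrc y hy
    exact contMDiffOn_iff_contDiffOn.1
      ((inTangentCoordinates_contMDiffOn_chartSource J hsm x₀).comp
        (contMDiffOn_extChartAt_symm x₀) hmaps)
  · -- `Jc y ∘ Jc y = -1` on the chart target
    intro y hy v
    have hx := hsrc y hy
    dsimp only
    rw [hexpr hx, hexpr hx, hBA hx, hJ2]
    exact ((tangentCoordChange (𝓡 4) _ x₀ _).map_neg _).trans (congrArg Neg.neg (hAB hx v))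
  · -- compatibility with the frame expression along the chart
    intro x hx
    have hx' : x ∈ (extChartAt (𝓡 4) x₀).source := by rwa [extChartAt_source]
    dsimp only
    rw [(extChartAt (𝓡 4) x₀).left_inv hx']

/-- **A globally smooth coordinate almost complex structure near a point.** With `J` as in
`exists_coordinateACS`, for every `x₀` there are a GLOBALLY `C^∞` field
`J' : ℝ⁴ → (ℝ⁴ →L[ℝ] ℝ⁴)` and `δ > 0` such that, for `x` in the chart domain of `x₀` with
`extChartAt x₀ x ∈ ball (extChartAt x₀ x₀) δ`, `J' (extChartAt x₀ x)` is the frame expression of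
`J x` and squares to `-1` (`J' = Jc ∘ rt` for the coordinate structure `Jc` of
`exists_coordinateACS` and a smooth retraction `rt` onto a ball inside the chart target).
[folklore] -/
theorem exists_coordinateACS_global
    (J : ∀ x : M, TangentSpace (𝓡 4) x →L[ℝ] TangentSpace (𝓡 4) x)
    (hJ2 : ∀ (x : M) (v : TangentSpace (𝓡 4) x), J x (J x v) = -v)
    (hsm : ∀ x₀ : M, ContMDiffAt (𝓡 4)
      𝓘(ℝ, EuclideanSpace ℝ (Fin 4) →L[ℝ] EuclideanSpace ℝ (Fin 4)) ∞
      (inTangentCoordinates (𝓡 4) (𝓡 4) (id : M → M) id (fun x => J x) x₀) x₀) (x₀ : M) :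
    ∃ (J' : EuclideanSpace ℝ (Fin 4) → EuclideanSpace ℝ (Fin 4) →L[ℝ] EuclideanSpace ℝ (Fin 4))
      (δ : ℝ), 0 < δ ∧ ContDiff ℝ ∞ J' ∧
      (∀ x ∈ (chartAt (EuclideanSpace ℝ (Fin 4)) x₀).source,
        extChartAt (𝓡 4) x₀ x ∈ ball (extChartAt (𝓡 4) x₀ x₀) δ →
          J' (extChartAt (𝓡 4) x₀ x) =
            inTangentCoordinates (𝓡 4) (𝓡 4) (id : M → M) id (fun x => J x) x₀ x) ∧
      ∀ x ∈ (chartAt (EuclideanSpace ℝ (Fin 4)) x₀).source,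
        extChartAt (𝓡 4) x₀ x ∈ ball (extChartAt (𝓡 4) x₀ x₀) δ →
          ∀ w, J' (extChartAt (𝓡 4) x₀ x) (J' (extChartAt (𝓡 4) x₀ x) w) = -w := by
  obtain ⟨Jc, hJc, hJc2, hJcE⟩ := exists_coordinateACS J hJ2 hsm x₀
  obtain ⟨δ₀, hδ₀, hball⟩ := Metric.isOpen_iff.1 (isOpen_extChartAt_target (I := 𝓡 4) x₀) _
    (mem_extChartAt_target (I := 𝓡 4) x₀)
  obtain ⟨rt, hrt, hrtmem, hrtid⟩ := exists_smooth_ballRetraction (extChartAt (𝓡 4) x₀ x₀) hδ₀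
  refine ⟨fun y => Jc (rt y), δ₀ / 2, by positivity, hJc.comp_contDiff hrt fun y => hball (hrtmem y),
    ?_, ?_⟩
  · intro x hx hxδ
    show Jc (rt _) = _
    rw [hrtid _ (ball_subset_closedBall hxδ)]
    exact hJcE x hx
  · intro x hx hxδ w
    show Jc (rt _) (Jc (rt _) w) = -w
    rw [hrtid _ (ball_subset_closedBall hxδ)]
    have hxt : extChartAt (𝓡 4) x₀ x ∈ (extChartAt (𝓡 4) x₀).target :=
      (extChartAt (𝓡 4) x₀).map_source (by rwa [extChartAt_source])
    exact hJc2 _ hxt w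

/-! ### Chart calculus for curves `ℂ → M` -/

/-- **A `J`-holomorphic curve is flat-holomorphic in a chart for the frame expression of `J`.**
If `u : ℂ → M` is smooth at `z`, `du(z)(iζ) = J (du(z) ζ)` for all `ζ`, and `u z` lies in the
source of the chart at `x₀`, then
`D(extChartAt x₀ ∘ u)(z)(iζ) = Jin (u z) (D(extChartAt x₀ ∘ u)(z) ζ)` where `Jin` is the frame
expression `inTangentCoordinates … x₀` of `J`. With `A = mfderiv (extChartAt x₀) (u z)` and
`B = mfderivWithin (range (𝓡 4)) (extChartAt x₀).symm (extChartAt x₀ (u z))`: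
`D(extChartAt x₀ ∘ u)(z) = A ∘ du(z)` (chain rule), `Jin (u z) = A ∘ J (u z) ∘ B`
(`inTangentCoordinates_eq_mfderiv_comp`) and `B ∘ A = id`
(`mfderivWithin_extChartAt_symm_comp_mfderiv_extChartAt'`). [folklore] -/
theorem jHolomorphic_fderiv_chart
    (J : ∀ x : M, TangentSpace (𝓡 4) x →L[ℝ] TangentSpace (𝓡 4) x) {x₀ : M} {u : ℂ → M} {z : ℂ}
    (hu : ContMDiffAt 𝓘(ℝ, ℂ) (𝓡 4) ∞ u z)
    (hhol : ∀ ζ : ℂ, mfderiv 𝓘(ℝ, ℂ) (𝓡 4) u z (Complex.I * ζ : ℂ) =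
      J (u z) (mfderiv 𝓘(ℝ, ℂ) (𝓡 4) u z (ζ : ℂ)))
    (hz : u z ∈ (chartAt (EuclideanSpace ℝ (Fin 4)) x₀).source) (ζ : ℂ) :
    fderiv ℝ (fun w : ℂ => extChartAt (𝓡 4) x₀ (u w)) z (Complex.I * ζ) =
      inTangentCoordinates (𝓡 4) (𝓡 4) (id : M → M) id (fun x => J x) x₀ (u z)
        (fderiv ℝ (fun w : ℂ => extChartAt (𝓡 4) x₀ (u w)) z ζ) := by
  -- chain rule: `D(φ₀ ∘ u)(z) v = A (du(z) v)`
  have hcomp : ∀ v : ℂ, fderiv ℝ (fun w : ℂ => extChartAt (𝓡 4) x₀ (u w)) z v =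
      mfderiv (𝓡 4) 𝓘(ℝ, EuclideanSpace ℝ (Fin 4)) (extChartAt (𝓡 4) x₀) (u z)
        (mfderiv 𝓘(ℝ, ℂ) (𝓡 4) u z v) := fun v => by
    have h := ((mdifferentiableAt_extChartAt (I := 𝓡 4) hz).hasMFDerivAt.comp z
      ((hu.mdifferentiableAt (by simp)).hasMFDerivAt)).mfderiv
    rw [mfderiv_eq_fderiv] at h
    exact DFunLike.congr_fun h v
  -- the frame expression `Jin (u z) = A ∘ J (u z) ∘ B`
  have hJin : ∀ v : EuclideanSpace ℝ (Fin 4),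
      inTangentCoordinates (𝓡 4) (𝓡 4) (id : M → M) id (fun x => J x) x₀ (u z) v =
        mfderiv (𝓡 4) 𝓘(ℝ, EuclideanSpace ℝ (Fin 4)) (extChartAt (𝓡 4) x₀) (u z)
          (J (u z) (mfderivWithin 𝓘(ℝ, EuclideanSpace ℝ (Fin 4)) (𝓡 4)
            (extChartAt (𝓡 4) x₀).symm (range (𝓡 4)) (extChartAt (𝓡 4) x₀ (u z)) v)) :=
    fun v => DFunLike.congr_fun (inTangentCoordinates_eq_mfderiv_comp (I := 𝓡 4) (I' := 𝓡 4)
      (f := (id : M → M)) (g := (id : M → M)) (ϕ := fun x => J x) (x₀ := x₀) (x := u z) hz hz) v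
  -- `B ∘ A = id`
  have hz' : u z ∈ (extChartAt (𝓡 4) x₀).source := by rwa [extChartAt_source]
  have hBA : ∀ v : TangentSpace (𝓡 4) (u z),
      mfderivWithin 𝓘(ℝ, EuclideanSpace ℝ (Fin 4)) (𝓡 4) (extChartAt (𝓡 4) x₀).symm
          (range (𝓡 4)) (extChartAt (𝓡 4) x₀ (u z))
        (mfderiv (𝓡 4) 𝓘(ℝ, EuclideanSpace ℝ (Fin 4)) (extChartAt (𝓡 4) x₀) (u z) v) = v :=
    fun v => DFunLike.congr_fun (mfderivWithin_extChartAt_symm_comp_mfderiv_extChartAt' hz') v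
  rw [hcomp, hcomp, hJin, hBA, hhol ζ]

/-- **Global smooth chart expression of a `J`-holomorphic curve near a point.** Let
`G : ℂ → M` be `C^∞` and `J`-holomorphic with `G z₀ = x₀`, and let `J'` agree with the frame
expression of `J` at the points `x` of the chart domain of `x₀` with
`extChartAt x₀ x ∈ ball (extChartAt x₀ x₀) δ`. Then there are a globally `C^∞` `u : ℂ → ℝ⁴` and
`R > 0` such that on `ball z₀ R`: `G z` lies in the chart domain, `u z = extChartAt x₀ (G z)` lies
in that ball, `u` is `J'`-holomorphic (`du (iα) = J' (u z) (du α)`), and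
`du(z₀) = mfderiv (extChartAt x₀) x₀ ∘ dG(z₀)`. (`u = extChartAt x₀ ∘ G ∘ rt` for a smooth
retraction `rt` of `ℂ` onto a small disc about `z₀`.) [folklore] -/
theorem exists_chartCurve_global
    (J : ∀ x : M, TangentSpace (𝓡 4) x →L[ℝ] TangentSpace (𝓡 4) x) {x₀ : M}
    {J' : EuclideanSpace ℝ (Fin 4) → EuclideanSpace ℝ (Fin 4) →L[ℝ] EuclideanSpace ℝ (Fin 4)}
    {δ : ℝ}
    (hJ' : ∀ x ∈ (chartAt (EuclideanSpace ℝ (Fin 4)) x₀).source,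
      extChartAt (𝓡 4) x₀ x ∈ ball (extChartAt (𝓡 4) x₀ x₀) δ →
        J' (extChartAt (𝓡 4) x₀ x) =
          inTangentCoordinates (𝓡 4) (𝓡 4) (id : M → M) id (fun x => J x) x₀ x)
    {G : ℂ → M} (hG : ContMDiff 𝓘(ℝ, ℂ) (𝓡 4) ∞ G) (hGJ : IsJHolomorphic (𝓡 4) J G)
    {z₀ : ℂ} (hz₀ : G z₀ = x₀) (hδ : 0 < δ) :
    ∃ (u : ℂ → EuclideanSpace ℝ (Fin 4)) (R : ℝ), 0 < R ∧ ContDiff ℝ ∞ u ∧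
      (∀ z ∈ ball z₀ R, G z ∈ (chartAt (EuclideanSpace ℝ (Fin 4)) x₀).source ∧
        u z = extChartAt (𝓡 4) x₀ (G z) ∧ u z ∈ ball (extChartAt (𝓡 4) x₀ x₀) δ) ∧
      (∀ z ∈ ball z₀ R, ∀ α : ℂ,
        fderiv ℝ u z (Complex.I * α) = J' (u z) (fderiv ℝ u z α)) ∧
      (Injective (mfderiv 𝓘(ℝ, ℂ) (𝓡 4) G z₀) → Injective (fderiv ℝ u z₀)) := by
  subst hz₀
  -- the open set where `G` stays in the chart domain of `x₀ = G z₀`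
  have hUo : IsOpen (G ⁻¹' (chartAt (EuclideanSpace ℝ (Fin 4)) (G z₀)).source) :=
    (chartAt (EuclideanSpace ℝ (Fin 4)) (G z₀)).open_source.preimage hG.continuous
  have hz₀src : G z₀ ∈ (chartAt (EuclideanSpace ℝ (Fin 4)) (G z₀)).source :=
    mem_chart_source _ (G z₀)
  -- the chart expression `f = extChartAt (G z₀) ∘ G` is smooth there
  have hfU : ContDiffOn ℝ ∞ (fun z : ℂ => extChartAt (𝓡 4) (G z₀) (G z))
      (G ⁻¹' (chartAt (EuclideanSpace ℝ (Fin 4)) (G z₀)).source) := fun z hz =>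
    (contMDiffAt_iff_contDiffAt.1
      ((contMDiffAt_iff_target_of_mem_source hz).1 (hG z)).2).contDiffWithinAt
  obtain ⟨δ₁, hδ₁, hballU⟩ := Metric.isOpen_iff.1 hUo z₀ hz₀src
  obtain ⟨rt, hrt, hrtmem, hrtid⟩ := exists_smooth_ballRetraction z₀ hδ₁
  -- the globalised chart expression
  obtain ⟨u, hu⟩ : ∃ u : ℂ → EuclideanSpace ℝ (Fin 4),
      u = (fun z : ℂ => extChartAt (𝓡 4) (G z₀) (G z)) ∘ rt := ⟨_, rfl⟩
  have hu_smooth : ContDiff ℝ ∞ u := hu ▸ hfU.comp_contDiff hrt fun z => hballU (hrtmem z)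
  have hu_eq : ∀ z ∈ ball z₀ (δ₁ / 2), u z = extChartAt (𝓡 4) (G z₀) (G z) := fun z hz => by
    rw [hu, comp_apply, hrtid z (ball_subset_closedBall hz)]
  have hu_ev : ∀ z ∈ ball z₀ (δ₁ / 2),
      u =ᶠ[𝓝 z] fun w : ℂ => extChartAt (𝓡 4) (G z₀) (G w) := fun z hz => by
    filter_upwards [isOpen_ball.mem_nhds hz] with y hy using hu_eq y hy
  have hδ₁2 : 0 < δ₁ / 2 := by positivity
  have hu₀ : u z₀ = extChartAt (𝓡 4) (G z₀) (G z₀) := hu_eq z₀ (mem_ball_self hδ₁2)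
  -- a radius on which `u` is the chart expression and stays in the small ball
  have hev : ∀ᶠ z in 𝓝 z₀,
      z ∈ ball z₀ (δ₁ / 2) ∧ u z ∈ ball (extChartAt (𝓡 4) (G z₀) (G z₀)) δ := by
    filter_upwards [isOpen_ball.mem_nhds (mem_ball_self hδ₁2),
      hu_smooth.continuous.continuousAt.preimage_mem_nhds
        (isOpen_ball.mem_nhds (by rw [hu₀]; exact mem_ball_self hδ))] with z h1 h2
    exact ⟨h1, h2⟩
  obtain ⟨R, hR, hRb⟩ := Metric.eventually_nhds_iff_ball.1 hev
  refine ⟨u, R, hR, hu_smooth, ?_, ?_, ?_⟩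
  · intro z hz
    obtain ⟨hz1, hz2⟩ := hRb z hz
    exact ⟨hballU (ball_subset_ball (by linarith) hz1), hu_eq z hz1, hz2⟩
  · intro z hz α
    obtain ⟨hz1, hz2⟩ := hRb z hz
    have hzU : G z ∈ (chartAt (EuclideanSpace ℝ (Fin 4)) (G z₀)).source :=
      hballU (ball_subset_ball (by linarith) hz1)
    rw [(hu_ev z hz1).fderiv_eq, jHolomorphic_fderiv_chart J (hG z) (hGJ z) hzU α,
      ← hJ' (G z) hzU (hu_eq z hz1 ▸ hz2), hu_eq z hz1]
  · -- `du(z₀) = A ∘ dG(z₀)` with `A = mfderiv (extChartAt (G z₀)) (G z₀)` left-invertible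
    intro hGinj w₁ w₂ hw
    have hcomp : ∀ v : ℂ, fderiv ℝ u z₀ v =
        mfderiv (𝓡 4) 𝓘(ℝ, EuclideanSpace ℝ (Fin 4)) (extChartAt (𝓡 4) (G z₀)) (G z₀)
          (mfderiv 𝓘(ℝ, ℂ) (𝓡 4) G z₀ v) := fun v => by
      have h := ((mdifferentiableAt_extChartAt (I := 𝓡 4) hz₀src).hasMFDerivAt.comp z₀
        (((hG z₀).mdifferentiableAt (by simp)).hasMFDerivAt)).mfderiv
      rw [mfderiv_eq_fderiv] at h
      rw [(hu_ev z₀ (mem_ball_self hδ₁2)).fderiv_eq]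
      exact DFunLike.congr_fun h v
    have hz' : G z₀ ∈ (extChartAt (𝓡 4) (G z₀)).source := by
      rw [extChartAt_source]; exact hz₀src
    have hBA : ∀ v : TangentSpace (𝓡 4) (G z₀),
        mfderivWithin 𝓘(ℝ, EuclideanSpace ℝ (Fin 4)) (𝓡 4) (extChartAt (𝓡 4) (G z₀)).symm
            (range (𝓡 4)) (extChartAt (𝓡 4) (G z₀) (G z₀))
          (mfderiv (𝓡 4) 𝓘(ℝ, EuclideanSpace ℝ (Fin 4)) (extChartAt (𝓡 4) (G z₀)) (G z₀) v) =
          v :=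
      fun v => DFunLike.congr_fun (mfderivWithin_extChartAt_symm_comp_mfderiv_extChartAt' hz') v
    rw [hcomp, hcomp] at hw
    have h' := congrArg (mfderivWithin 𝓘(ℝ, EuclideanSpace ℝ (Fin 4)) (𝓡 4)
      (extChartAt (𝓡 4) (G z₀)).symm (range (𝓡 4)) (extChartAt (𝓡 4) (G z₀) (G z₀))) hw
    rw [hBA, hBA] at h'
    exact hGinj h'

end Chart

end Literature.Geometry.Symplectic
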